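import Mathlib
import Literature.Barriers.MatrixMultiplication.NormalizerBarrier
import Summits.MatrixMultiplication.MatrixMultiplication.Theorems.SubgroupIdentityDesigns.Negative.LevelOneSandwichRigidity

/-!
# Stub `stub_levelKSandwichRigidity` — line `ghost-calculus-chebotarev` of the crux
`SubgroupIdentityDesigns` (stmt-MatrixMultiplication-14079)

Crux
`Summit.MatrixMultiplication.MatrixMultiplication.Theses.LevelGradedCohnUmans.SubgroupIdentityDesigns`;
this file proves the registered NEGATIVE helper `stub_levelKSandwichRigidity` verbatim (name +
signature): the general-level-`k` structure theorem for sandwich witnesses, generalising the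
level-one file `LevelOneSandwichRigidity`.  Pure group theory / linear algebra, no Fourier analysis.

Setting.  `G = GL_m(𝔽_p)` with `2k < m`, indices `Fin m` split into the "top" block `{i < k}` and
the "bottom" block `{k ≤ i}`; three subgroups `H₁, H₂, H₃ ≤ G` with the subgroup triple product
property (`Literature.Barriers.MatrixMultiplication.SubgroupTPP`); the two block root groups
`U⁻ = {u : (u - 1) i j ≠ 0 → k ≤ i ∧ j < k}` (unipotents supported in the bottom-left block) and
`U⁺ = {v : (v - 1) i j ≠ 0 → i < k ∧ k ≤ j}` (top-right block).  Hypotheses: `U⁻ ≤ H₁`, `U⁺ ≤ H₃`,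
and the SLICE property (every product `a b g`, `a ∈ H₁, b ∈ H₂, g ∈ H₃`, whose top-left `k × k`
block agrees with the identity factors as `u v` with `u` of `U⁻`-shape and `v` of `U⁺`-shape).
Conclusions:

* (C1) every `h ∈ H₁` has zero top-right block (`H₁` is block-lower-triangular);
* (C2) every `h ∈ H₁` with identity top-left block is `U⁻`-shaped;
* (C3) every `h ∈ H₃` has zero bottom-left block (`H₃` is block-upper-triangular);
* (C4) every `h ∈ H₃` with identity top-left block is `U⁺`-shaped;
* (C5) `b ≠ 1 ⇒` the top-left block of `a b g - 1` is not zero.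

Proof.  TPP gives `H₁ ∩ H₃ = 1` (`LevelOneRigidity.eq_one_of_mem_left_right`, imported from the
level-one file).  (C5): a product with identity top-left block slices as
`a b g = u v`, so `(u⁻¹ a) b (g v⁻¹) = 1` and TPP forces `b = 1`.  (C2)/(C4): slice
`h = h·1·1 = u v`; then `v = u⁻¹ h ∈ H₁ ∩ H₃` (resp. `u = h v⁻¹ ∈ H₁ ∩ H₃`) is trivial.
(C1) is a conjugation/kernel argument (`LevelKRigidity.topRight_eq_zero`): for `h ∈ H₁` and a
matrix `x` supported in the bottom-left block, `u = 1 + x ∈ U⁻ ≤ H₁` (`x² = 0`,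
`LevelKRigidity.exists_unipotent`), so `w = h⁻¹ u h = 1 + h⁻¹ x h ∈ H₁`.  Take the rank-one
`x = y ⊗ e_{i₀}` (`Matrix.vecMulVec`; column `i₀ < k` equal to a vector `y` supported on the
bottom coordinates); then `h⁻¹ x h = (h⁻¹ y) ⊗ (row i₀ of h)`.  If the top
coordinates of `h⁻¹ y` vanish, the top-left block of `w - 1` is zero, so by (C2) `w` is
`U⁻`-shaped, whence `(h⁻¹ y)_r · h_{i₀ j} = 0` for all `r` and all `j ≥ k`.  If some
`h_{i₀ j₀} ≠ 0` with `i₀ < k ≤ j₀`, this forces `h⁻¹ y = 0`, i.e. `y = 0`: the linear map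
`y ↦ (top coordinates of h⁻¹ y)` from the `(m - k)`-dimensional bottom space to `𝔽_p^k` would be
injective, impossible as `k < m - k` (`LevelKRigidity.exists_ker_vec`, rank–nullity).  (C3) is
the transposed statement (`LevelKRigidity.botLeft_eq_zero`), applied with `w = h v h⁻¹`,
`v = 1 + z ∈ U⁺ ≤ H₃`, and (C4).  Sorry-free; standard axioms.
-/

set_option linter.dupNamespace false

noncomputable section

open scoped BigOperators
open Literature.Barriers.MatrixMultiplication

namespace Summit.MatrixMultiplication.MatrixMultiplication.Theorems.SubgroupIdentityDesigns.Negative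

namespace LevelKRigidity

/-! ## Linear algebra: a kernel vector and square-zero unipotents -/

/-- **Kernel vector.**  If `2k < m`, then for every `m × m` matrix `M` over a field there is a
nonzero vector `y` supported on the coordinates `≥ k` such that the first `k` coordinates of
`M y` vanish: the linear map from the `(m - k)`-dimensional bottom coordinate space to the
`k`-dimensional top one has a nontrivial kernel (rank–nullity). [folklore] -/
theorem exists_ker_vec {K : Type*} [Field K] {m k : ℕ} (hkm : 2 * k < m)
    (M : Matrix (Fin m) (Fin m) K) :
    ∃ y : Fin m → K, y ≠ 0 ∧ (∀ l : Fin m, l.val < k → y l = 0) ∧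
      ∀ i : Fin m, i.val < k → M.mulVec y i = 0 := by
  obtain ⟨d, rfl⟩ := Nat.exists_eq_add_of_le (show k ≤ m by omega)
  -- the top-right block of `M`, as a `k × d` matrix
  obtain ⟨B, hB⟩ : ∃ B : Matrix (Fin k) (Fin d) K,
      ∀ i c, B i c = M (Fin.castAdd d i) (Fin.natAdd k c) :=
    ⟨Matrix.of fun i c => M (Fin.castAdd d i) (Fin.natAdd k c), fun _ _ => rfl⟩
  have hlt : Module.finrank K (Fin k → K) < Module.finrank K (Fin d → K) := by
    rw [Module.finrank_fin_fun, Module.finrank_fin_fun]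
    omega
  obtain ⟨z, hz, hz0⟩ := (Submodule.ne_bot_iff _).mp
    (LinearMap.ker_ne_bot_of_finrank_lt (f := B.mulVecLin) hlt)
  rw [LinearMap.mem_ker, Matrix.mulVecLin_apply] at hz
  refine ⟨Fin.append (0 : Fin k → K) z, ?_, ?_, ?_⟩
  · intro h0
    apply hz0
    funext c
    have hc := congrFun h0 (Fin.natAdd k c)
    rwa [Fin.append_right] at hc
  · intro l hl
    obtain ⟨l, rfl⟩ : ∃ l' : Fin k, l = Fin.castAdd d l' := ⟨⟨l.val, hl⟩, Fin.ext rfl⟩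
    rw [Fin.append_left, Pi.zero_apply]
  · intro i hi
    obtain ⟨i, rfl⟩ : ∃ i' : Fin k, i = Fin.castAdd d i' := ⟨⟨i.val, hi⟩, Fin.ext rfl⟩
    have hzi := congrFun hz i
    simp only [Matrix.mulVec, dotProduct, Pi.zero_apply, hB] at hzi
    simp only [Matrix.mulVec, dotProduct, Fin.sum_univ_add, Fin.append_left, Fin.append_right,
      Pi.zero_apply, mul_zero, Finset.sum_const_zero, zero_add]
    exact hzi

/-- Conjugating the rank-one matrix `y ⊗ e_c` (column `c` equal to `y`, all other columns zero):
`(A (y ⊗ e_c) B)_{r j} = (A y)_r B_{c j}`. [folklore] -/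
theorem conj_vecMulVec_single_apply {K : Type*} [Field K] {m : ℕ}
    (A B : Matrix (Fin m) (Fin m) K) (y : Fin m → K) (c r j : Fin m) :
    (A * Matrix.vecMulVec y (Pi.single c 1) * B) r j = A.mulVec y r * B c j := by
  rw [Matrix.mul_vecMulVec, Matrix.vecMulVec_mul, Matrix.single_one_vecMul,
    Matrix.vecMulVec_apply]
  rfl

/-- A matrix supported in an off-diagonal block (rows inside a set `P` of indices, columns
outside `P`) has square zero. [folklore] -/
theorem mul_self_eq_zero_of_offDiag {K : Type*} [Field K] {m : ℕ} (P : Fin m → Prop)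
    (x : Matrix (Fin m) (Fin m) K) (hx : ∀ i j, x i j ≠ 0 → P i ∧ ¬ P j) : x * x = 0 := by
  ext i j
  rw [Matrix.mul_apply, Matrix.zero_apply]
  refine Finset.sum_eq_zero fun l _ => ?_
  by_cases h1 : x i l = 0
  · rw [h1, zero_mul]
  by_cases h2 : x l j = 0
  · rw [h2, mul_zero]
  exact absurd (hx l j h2).1 (hx i l h1).2

/-- A square-zero matrix `x` gives the unipotent invertible matrix `1 + x`
(inverse `1 - x`). [folklore] -/
theorem exists_unipotent {K : Type*} [Field K] {m : ℕ} (x : Matrix (Fin m) (Fin m) K)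
    (hx : x * x = 0) :
    ∃ u : Matrix.GeneralLinearGroup (Fin m) K, (u : Matrix (Fin m) (Fin m) K) = 1 + x :=
  ⟨⟨1 + x, 1 - x,
    by rw [show (1 + x) * (1 - x) = 1 - x * x by noncomm_ring, hx, sub_zero],
    by rw [show (1 - x) * (1 + x) = 1 - x * x by noncomm_ring, hx, sub_zero]⟩, rfl⟩

/-! ## The conjugation/kernel argument -/

/-- **Column kernel argument.**  Let `2k < m` and let `h` be a matrix with right inverse `h'`.
Suppose that for every matrix `x` supported in the bottom-left block `{k ≤ l} × {i < k}` the
conjugate `h' x h` is supported in the bottom-left block as soon as its top-left block vanishes.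
Then the top-right block of `h` is zero.  (Test with `x = y e_{i₀}ᵀ`, `y` a kernel vector of
`exists_ker_vec` for `h'`: `h' x h = (h' y) ⊗ (row i₀ of h)`, and a nonzero `h_{i₀ j₀}` with
`j₀ ≥ k` would force `h' y = 0`, i.e. `y = 0`.) [folklore] -/
theorem topRight_eq_zero {K : Type*} [Field K] {m k : ℕ} (hkm : 2 * k < m)
    (h h' : Matrix (Fin m) (Fin m) K) (hinv : h * h' = 1)
    (H : ∀ x : Matrix (Fin m) (Fin m) K, (∀ l i : Fin m, x l i ≠ 0 → k ≤ l.val ∧ i.val < k) →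
      (∀ r j : Fin m, r.val < k → j.val < k → (h' * x * h) r j = 0) →
      ∀ r j : Fin m, (h' * x * h) r j ≠ 0 → k ≤ r.val ∧ j.val < k) :
    ∀ i j : Fin m, i.val < k → k ≤ j.val → h i j = 0 := by
  intro i₀ j₀ hi₀ hj₀
  by_contra hne
  obtain ⟨y, hy0, hysupp, hytop⟩ := exists_ker_vec hkm h'
  -- the test matrix `x = y ⊗ e_{i₀}` is supported in the bottom-left block
  set x : Matrix (Fin m) (Fin m) K := Matrix.vecMulVec y (Pi.single i₀ 1) with hx
  have hxsupp : ∀ l i : Fin m, x l i ≠ 0 → k ≤ l.val ∧ i.val < k := by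
    intro l i hli
    rw [hx, Matrix.vecMulVec_apply] at hli
    by_cases hi : i = i₀
    · refine ⟨?_, by rw [hi]; exact hi₀⟩
      by_contra hlk
      exact hli (by rw [hysupp l (not_le.mp hlk), zero_mul])
    · exact absurd (by rw [Pi.single_eq_of_ne hi, mul_zero]) hli
  -- its conjugate is the rank-one matrix `(h' y) ⊗ (row i₀ of h)`
  have hconj : ∀ r j : Fin m, (h' * x * h) r j = h'.mulVec y r * h i₀ j := fun r j => by
    rw [hx, conj_vecMulVec_single_apply]
  have htl : ∀ r j : Fin m, r.val < k → j.val < k → (h' * x * h) r j = 0 := by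
    intro r j hr _
    rw [hconj, hytop r hr, zero_mul]
  have hshape := H x hxsupp htl
  -- hence `h' y = 0`, so `y = h (h' y) = 0`: contradiction
  have hzero : h'.mulVec y = 0 := by
    funext r
    by_contra hr
    have hne' : (h' * x * h) r j₀ ≠ 0 := by
      rw [hconj]
      exact mul_ne_zero hr hne
    have hlt := (hshape r j₀ hne').2
    omega
  apply hy0
  calc y = (h * h').mulVec y := by rw [hinv, Matrix.one_mulVec]
    _ = 0 := by rw [← Matrix.mulVec_mulVec, hzero, Matrix.mulVec_zero]

/-- **Row kernel argument** (the transpose of `topRight_eq_zero`).  Let `2k < m` and let `h` be a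
matrix with left inverse `h'`.  Suppose that for every matrix `z` supported in the top-right
block `{i < k} × {k ≤ l}` the conjugate `h z h'` is supported in the top-right block as soon as
its top-left block vanishes.  Then the bottom-left block of `h` is zero. [folklore] -/
theorem botLeft_eq_zero {K : Type*} [Field K] {m k : ℕ} (hkm : 2 * k < m)
    (h h' : Matrix (Fin m) (Fin m) K) (hinv : h' * h = 1)
    (H : ∀ z : Matrix (Fin m) (Fin m) K, (∀ i l : Fin m, z i l ≠ 0 → i.val < k ∧ k ≤ l.val) →
      (∀ r j : Fin m, r.val < k → j.val < k → (h * z * h') r j = 0) →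
      ∀ r j : Fin m, (h * z * h') r j ≠ 0 → r.val < k ∧ k ≤ j.val) :
    ∀ i j : Fin m, k ≤ i.val → j.val < k → h i j = 0 := by
  intro i j hi hj
  have key := topRight_eq_zero hkm h.transpose h'.transpose
    (by rw [← Matrix.transpose_mul, hinv, Matrix.transpose_one]) ?_ j i hj hi
  · simpa using key
  · intro x hxsupp htl r j' hrj
    have htr : h'.transpose * x * h.transpose = (h * x.transpose * h').transpose := by
      rw [Matrix.transpose_mul, Matrix.transpose_mul, Matrix.transpose_transpose,
        Matrix.mul_assoc]
    rw [htr, Matrix.transpose_apply] at hrj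
    have hz : ∀ i l : Fin m, x.transpose i l ≠ 0 → i.val < k ∧ k ≤ l.val := by
      intro i l hil
      rw [Matrix.transpose_apply] at hil
      exact (hxsupp l i hil).symm
    have htl' : ∀ r j : Fin m, r.val < k → j.val < k → (h * x.transpose * h') r j = 0 := by
      intro r j hr hj
      have h0 := htl j r hj hr
      rwa [htr, Matrix.transpose_apply] at h0
    exact (H x.transpose hz htl' j' r hrj).symm

end LevelKRigidity

open LevelKRigidity LevelOneRigidity in
/-- **Level-`k` sandwich rigidity** (negative helper for the line `ghost-calculus-chebotarev` of
the crux `SubgroupIdentityDesigns`).  In `GL_m(𝔽_p)` with `2k < m` let `H₁, H₂, H₃` satisfy the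
subgroup TPP, let `H₁` contain the bottom-left block root group `U⁻` and `H₃` the top-right block
root group `U⁺`, and assume the SLICE property: every product `a b g` (`a ∈ H₁, b ∈ H₂, g ∈ H₃`)
whose top-left `k × k` block is the identity factors as `u v` with `u` of `U⁻`-shape and `v` of
`U⁺`-shape.  Then (C1) `H₁` is block-lower-triangular, (C2) the elements of `H₁` with identity
top-left block are exactly `U⁻`-shaped, (C3) `H₃` is block-upper-triangular, (C4) the elements of
`H₃` with identity top-left block are `U⁺`-shaped, and (C5) a product `a b g` with `b ≠ 1` never
has identity top-left block. -/
theorem stub_levelKSandwichRigidity :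
    ∀ (p : ℕ) [Fact p.Prime] (m k : ℕ), 2 * k < m →
      ∀ (H₁ H₂ H₃ : Subgroup (Matrix.GeneralLinearGroup (Fin m) (ZMod p))),
      Literature.Barriers.MatrixMultiplication.SubgroupTPP H₁ H₂ H₃ →
      (∀ u : Matrix.GeneralLinearGroup (Fin m) (ZMod p),
        (∀ i j : Fin m, ((u : Matrix (Fin m) (Fin m) (ZMod p)) - 1) i j ≠ 0 → k ≤ i.val ∧ j.val < k) →
          u ∈ H₁) →
      (∀ v : Matrix.GeneralLinearGroup (Fin m) (ZMod p),
        (∀ i j : Fin m, ((v : Matrix (Fin m) (Fin m) (ZMod p)) - 1) i j ≠ 0 → i.val < k ∧ k ≤ j.val) →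
          v ∈ H₃) →
      (∀ a ∈ H₁, ∀ b ∈ H₂, ∀ g ∈ H₃,
        (∀ i j : Fin m, i.val < k → j.val < k →
          (((a * b * g : Matrix.GeneralLinearGroup (Fin m) (ZMod p)) : Matrix (Fin m) (Fin m) (ZMod p)) - 1)
            i j = 0) →
        ∃ u v : Matrix.GeneralLinearGroup (Fin m) (ZMod p),
          (∀ i j : Fin m, ((u : Matrix (Fin m) (Fin m) (ZMod p)) - 1) i j ≠ 0 → k ≤ i.val ∧ j.val < k) ∧
          (∀ i j : Fin m, ((v : Matrix (Fin m) (Fin m) (ZMod p)) - 1) i j ≠ 0 → i.val < k ∧ k ≤ j.val) ∧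
          a * b * g = u * v) →
      (∀ h ∈ H₁, ∀ i j : Fin m, i.val < k → k ≤ j.val → (h : Matrix (Fin m) (Fin m) (ZMod p)) i j = 0) ∧
      (∀ h ∈ H₁, (∀ i j : Fin m, i.val < k → j.val < k →
          ((h : Matrix (Fin m) (Fin m) (ZMod p)) - 1) i j = 0) →
        ∀ i j : Fin m, ((h : Matrix (Fin m) (Fin m) (ZMod p)) - 1) i j ≠ 0 → k ≤ i.val ∧ j.val < k) ∧
      (∀ h ∈ H₃, ∀ i j : Fin m, k ≤ i.val → j.val < k → (h : Matrix (Fin m) (Fin m) (ZMod p)) i j = 0) ∧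
      (∀ h ∈ H₃, (∀ i j : Fin m, i.val < k → j.val < k →
          ((h : Matrix (Fin m) (Fin m) (ZMod p)) - 1) i j = 0) →
        ∀ i j : Fin m, ((h : Matrix (Fin m) (Fin m) (ZMod p)) - 1) i j ≠ 0 → i.val < k ∧ k ≤ j.val) ∧
      (∀ a ∈ H₁, ∀ b ∈ H₂, ∀ g ∈ H₃, b ≠ 1 →
        ∃ i j : Fin m, i.val < k ∧ j.val < k ∧
          (((a * b * g : Matrix.GeneralLinearGroup (Fin m) (ZMod p)) : Matrix (Fin m) (Fin m) (ZMod p)) - 1)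
            i j ≠ 0) := by
  intro p _ m k hkm H₁ H₂ H₃ htpp hL hR hslice
  -- (T0) `H₁ ∩ H₃ = 1`.
  have h13 : ∀ t, t ∈ H₁ → t ∈ H₃ → t = 1 := fun t h1 h3 =>
    eq_one_of_mem_left_right htpp h1 h3
  -- (C5) `b ≠ 1 ⇒` the top-left block of `a b g - 1` is nonzero.
  have hC5 : ∀ a ∈ H₁, ∀ b ∈ H₂, ∀ g ∈ H₃, b ≠ 1 →
      ∃ i j : Fin m, i.val < k ∧ j.val < k ∧
        (((a * b * g : Matrix.GeneralLinearGroup (Fin m) (ZMod p)) :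
          Matrix (Fin m) (Fin m) (ZMod p)) - 1) i j ≠ 0 := by
    intro a ha b hb g hg hb1
    by_contra hall
    push Not at hall
    obtain ⟨u, v, hu, hv, he⟩ := hslice a ha b hb g hg hall
    have key : u⁻¹ * a * b * (g * v⁻¹) = 1 := by
      calc u⁻¹ * a * b * (g * v⁻¹) = u⁻¹ * (a * b * g) * v⁻¹ := by group
        _ = 1 := by rw [he]; group
    exact hb1 (htpp _ (H₁.mul_mem (H₁.inv_mem (hL u hu)) ha) b hb _
      (H₃.mul_mem hg (H₃.inv_mem (hR v hv))) key).2.1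
  -- (C2) elements of `H₁` with identity top-left block are `U⁻`-shaped.
  have hC2 : ∀ h ∈ H₁, (∀ i j : Fin m, i.val < k → j.val < k →
        ((h : Matrix (Fin m) (Fin m) (ZMod p)) - 1) i j = 0) →
      ∀ i j : Fin m, ((h : Matrix (Fin m) (Fin m) (ZMod p)) - 1) i j ≠ 0 →
        k ≤ i.val ∧ j.val < k := by
    intro h hh hcorner
    obtain ⟨u, v, hu, hv, he⟩ :=
      hslice h hh 1 H₂.one_mem 1 H₃.one_mem (by simpa only [mul_one] using hcorner)
    simp only [mul_one] at he
    have hv1 : v ∈ H₁ := by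
      have huv : u⁻¹ * h = v := by rw [he, inv_mul_cancel_left]
      exact huv ▸ H₁.mul_mem (H₁.inv_mem (hL u hu)) hh
    rw [h13 v hv1 (hR v hv), mul_one] at he
    subst he
    exact hu
  -- (C4) elements of `H₃` with identity top-left block are `U⁺`-shaped.
  have hC4 : ∀ h ∈ H₃, (∀ i j : Fin m, i.val < k → j.val < k →
        ((h : Matrix (Fin m) (Fin m) (ZMod p)) - 1) i j = 0) →
      ∀ i j : Fin m, ((h : Matrix (Fin m) (Fin m) (ZMod p)) - 1) i j ≠ 0 →
        i.val < k ∧ k ≤ j.val := by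
    intro h hh hcorner
    obtain ⟨u, v, hu, hv, he⟩ :=
      hslice 1 H₁.one_mem 1 H₂.one_mem h hh (by simpa only [one_mul] using hcorner)
    simp only [one_mul] at he
    have hu3 : u ∈ H₃ := by
      have huv : h * v⁻¹ = u := by rw [he, mul_inv_cancel_right]
      exact huv ▸ H₃.mul_mem hh (H₃.inv_mem (hR v hv))
    rw [h13 u (hL u hu) hu3, one_mul] at he
    subst he
    exact hv
  -- (C1) `H₁` is block-lower-triangular: conjugate `U⁻` by `h` and use (C2).
  have hC1 : ∀ h ∈ H₁, ∀ i j : Fin m, i.val < k → k ≤ j.val →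
      (h : Matrix (Fin m) (Fin m) (ZMod p)) i j = 0 := by
    intro h hh
    refine topRight_eq_zero hkm (h : Matrix (Fin m) (Fin m) (ZMod p))
      ((h⁻¹ : Matrix.GeneralLinearGroup (Fin m) (ZMod p)) : Matrix (Fin m) (Fin m) (ZMod p))
      h.mul_inv ?_
    intro x hx htl
    obtain ⟨u, hu_val⟩ := exists_unipotent x (mul_self_eq_zero_of_offDiag
      (fun l : Fin m => k ≤ l.val) x fun l i hli => ⟨(hx l i hli).1, not_le.mpr (hx l i hli).2⟩)
    have hu : u ∈ H₁ :=
      hL u fun i j hij => hx i j (by rwa [hu_val, add_sub_cancel_left] at hij)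
    have hw : h⁻¹ * u * h ∈ H₁ := H₁.mul_mem (H₁.mul_mem (H₁.inv_mem hh) hu) hh
    have hmat : ((h⁻¹ * u * h : Matrix.GeneralLinearGroup (Fin m) (ZMod p)) :
          Matrix (Fin m) (Fin m) (ZMod p)) - 1 =
        ((h⁻¹ : Matrix.GeneralLinearGroup (Fin m) (ZMod p)) : Matrix (Fin m) (Fin m) (ZMod p)) *
          x * (h : Matrix (Fin m) (Fin m) (ZMod p)) := by
      rw [Units.val_mul, Units.val_mul, hu_val, mul_add, mul_one, add_mul, Units.inv_mul,
        add_sub_cancel_left]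
    have hshape := hC2 _ hw (by rw [hmat]; exact htl)
    rw [hmat] at hshape
    exact hshape
  -- (C3) `H₃` is block-upper-triangular: conjugate `U⁺` by `h` and use (C4).
  have hC3 : ∀ h ∈ H₃, ∀ i j : Fin m, k ≤ i.val → j.val < k →
      (h : Matrix (Fin m) (Fin m) (ZMod p)) i j = 0 := by
    intro h hh
    refine botLeft_eq_zero hkm (h : Matrix (Fin m) (Fin m) (ZMod p))
      ((h⁻¹ : Matrix.GeneralLinearGroup (Fin m) (ZMod p)) : Matrix (Fin m) (Fin m) (ZMod p))
      h.inv_mul ?_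
    intro z hz htl
    obtain ⟨v, hv_val⟩ := exists_unipotent z (mul_self_eq_zero_of_offDiag
      (fun l : Fin m => l.val < k) z fun i l hil => ⟨(hz i l hil).1, not_lt.mpr (hz i l hil).2⟩)
    have hv : v ∈ H₃ :=
      hR v fun i j hij => hz i j (by rwa [hv_val, add_sub_cancel_left] at hij)
    have hw : h * v * h⁻¹ ∈ H₃ := H₃.mul_mem (H₃.mul_mem hh hv) (H₃.inv_mem hh)
    have hmat : ((h * v * h⁻¹ : Matrix.GeneralLinearGroup (Fin m) (ZMod p)) :
          Matrix (Fin m) (Fin m) (ZMod p)) - 1 =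
        (h : Matrix (Fin m) (Fin m) (ZMod p)) * z *
          ((h⁻¹ : Matrix.GeneralLinearGroup (Fin m) (ZMod p)) : Matrix (Fin m) (Fin m) (ZMod p)) := by
      rw [Units.val_mul, Units.val_mul, hv_val, mul_add, mul_one, add_mul, Units.mul_inv,
        add_sub_cancel_left]
    have hshape := hC4 _ hw (by rw [hmat]; exact htl)
    rw [hmat] at hshape
    exact hshape
  exact ⟨hC1, hC2, hC3, hC4, hC5⟩

end Summit.MatrixMultiplication.MatrixMultiplication.Theorems.SubgroupIdentityDesigns.Negative
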